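/-
Copyright (c) 2026 the pub-hodgecm-mathlib formalisation cell (harness21).  Prover seat hodgecm-mathlib-LH7-p08 (g3), req620 Track A «(D-RAM) FOUR-FRAME» squad
(STAGE-1b, row (2) of the piece `f_{T₊}`, the (β₂) road (R-36) «PURE-CELL LEDGER», K6 road; K6 desk LH4-p16 (g3) DESK WORD #9 (a) «= GO Q1» — FILE Q1b, the COUNT over the twist
toolkit ★ p864536), 2026-09-05.
-/
import Summits.HodgeConjecture.HodgeConjecture.Theorems.F0P3cDyRamRowCellDigitClassTwist   -- ★ p864536 (this seat): the twist toolkit; brings ★ p864480 (d′), ★ p864361 (d), ★ p863914 §0, ★ p862871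
import HarnessLib

/-!
# Crux `H413`, line LH4 «(D-RAM) FOUR-FRAME» — STAGE-1b, row (2), the (β₂) road (R-36), K6-(d″-Q) FILE Q1b: «INNER SHELLS AND THE DIAGONAL BALL ARE BALANCED; FAR SHELLS ARE
# ONE-CLASS» — the class-split COUNTS of the digit line in the ONE chart: on every sphere of radius `R` with `R·|ϖE|^{2d−2} < 1` (the diagonal ball and the cells `1 ≤ i ≤ d − 2`)
# the digits of the two literal classes are equinumerous; on the far spheres (`i ≥ d`) every digit is of the hyperbolic class

Cell `hodgecm-mathlib` (D-0151), FLOOR 0, crux item H413 = `stmt-HodgeConjecture-24833`, route of record `HCCMUnconditional`; squad F0∕P3c∕LH7 (hand lent to the LH4 β₂ board);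
lane `--supports stmt-HodgeConjecture-24833 --as helper` (count-neutral; pays NO tier-0 row).  THEOREMS ONLY (no `def`, no instance, no notation, no `sorry`, default heartbeats);
★-only imports; states NO law; (β₂) stays a HYPOTHESIS.

WHAT (K6 desk LH4-p16 (g3) WORD #6 (C) ∕ #9 (a); consumers: LH7-p06 (g3)'s ★ p864447 `density_of_tables` letters `hL0`, `hLNear`, `hLFar` read with the (d″-T) totals ★ p864509
`…OneChartDigitTotals`, and the K6-(e) spine ★ p864465).  CURRENCY = (d″-T)'s: the ONE chart of ★ p864361 §7 (`κ₀` of `ρ`-trace one, `Θ`-fixed, `|κ₀| = 1`; `ξ₀` `ρ`-anti, `Θ`-fixed, `≠ 0`);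
a digit system `Rd` of `σ`-fixed integral digits, complete and separated at precision `r` (★ p863833's `hRd2 ∕ hRd3`); the sphere of radius `R`: `Rd.filter (fun V ↦ max 1 (|V|·|ξ₀|) = R)`
(★ `sphereClause_iff_max_eq`: `R = exp(j − b)`; the diagonal ball is `R = 1`); the class predicate of a doubly-fixed scalar `c ≠ 0` (`hρh` or `h′ρh′`):
`CLASS_c V :≡ ∃ e, ρe = e ∧ eΘe = (κ₀ + jE V·ξ₀)·ρ(κ₀ + jE V·ξ₀) ∕ c`.
* §1 HEAD `card_filter_class_eq_card_filter_not_class` — «BALANCE»: for `1 ≤ R ≤ |ξ₀|`, `R·|ϖ|^{2d−2} < 1`, `r·|ξ₀| < R`, `r·|ξ₀| ≤ |ϖ|^{2d−1}·R` (`2 ≤ d`, `|2| < 1`):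
  `#((Rd.filter sphere_R).filter CLASS_c) = #((Rd.filter sphere_R).filter ¬CLASS_c)`.  MECHANISM (★ p864536): the twist unit `η = 1 + jE t₀·κ₀` (`N_ρη ∉ 𝒩`), the twist `Tκ = ηκ∕Tr_ρ(ηκ)`
  (line-, `Θ`-, sphere-preserving, isometric, class-FLIPPING on spheres `R·|ϖ|^{2d−2} < 1`), the digit map `V ↦` the digit within `r` of `T`'s coordinate (★ `exists_doublyFixed_coord`):
  it lands on the same sphere, has the OPPOSITE class (★ `classClause_twist_iff_not` × ★ `classClause_iff_of_near`) and is INJECTIVE on the sphere (★ `twist_sub_twist` + separation) — so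
  `Finset.card_le_card_of_injOn` both ways.  `two_mul_card_filter_class_eq_card`: `2·#(… CLASS_c) = #(Rd.filter sphere_R)` (= `hL0` at `R = 1`, `hLNear` at `R = exp 2i`, `1 ≤ i ≤ d − 2`,
  for BOTH literals `c = hρh, h′ρh′`).
* §2 FAR SHELLS (★ p864480 (d′2)+(d′1) as counts, CORE frame letters): `filter_class_eq_of_far` (`(S.filter CLASS_h) = S`), `filter_class'_eq_empty_of_far` (`(S.filter CLASS_{h′}) = ∅`),
  `card_filter_class_of_far` (`#… = #S` and `#… = 0` = `hLFar`) for any `S ⊆ Rd` whose digits satisfy `exp(2d − 1) ≤ |V|·|ξ₀|`.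
WHAT IS NOT CLAIMED: the boundary shell `i = d − 1` (LH4-p11 (g11), Q2 `…RowCellDigitClassBoundary`), the shell TOTALS (★ p864509), any census identity, (hI)(hV)(hP)(hF) (★).
HONEST LABEL.  Count-neutral finite bookkeeping; nothing printed is asserted; no census law is stated; `HC_CM` is proved only modulo the 7 printed citations (2 remaining named inputs:
hLiu418 = `stmt-HodgeConjecture-24832`, h413 = `stmt-HodgeConjecture-24833`) until rung 0 closes.
## References
* [Serre1979] J.-P. Serre, *Local Fields*, GTM 67 (1979): Ch. II §4 Prop. 5 p. 32 (representatives), Ch. V §2 Prop. 3 p. 81, Ch. V §3 Prop. 5, Cor. 2–3 pp. 84–86, Ch. XV §2.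
* [LabesseLanglands1979] J.-P. Labesse, R. P. Langlands, *L-indistinguishability for SL(2)*, Canad. J. Math. 31 (1979): §2 (2.2) p. 9 (κ-signed counts: the twist by a non-norm).
* [Flicker1998UnitaryFL] Y. Z. Flicker, *Elementary proof of the fundamental lemma for a unitary group*, Canad. J. Math. 50 (1998): Prop. 7 p. 84 (type RamK census by classes).
* [Kottwitz1986BaseChangeUnits] R. E. Kottwitz, *Base change for unit elements of Hecke algebras*, Compositio Math. 60 (1986): §1 pp. 240–241 (fixed-lattice counts as orbital integrals).
-/

set_option autoImplicit false

noncomputable section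

namespace Summit.HodgeConjecture.HodgeConjecture.Cruxes.H413.F0P3cDyRamRowCellDigitClassBalance

open scoped Valued WithZero
open WithZero Finset
open Literature.NumberTheory.Automorphic Literature.NumberTheory.Automorphic.UnitaryLatticeTree
open Literature.NumberTheory.Automorphic.UnitaryThreeFourFrame (IsRamifiedQuadraticDatum)
open Summit.HodgeConjecture.HodgeConjecture.Cruxes.H413.F0P3cDyRamRowCellSocketReads (exists_indexTwo_letters)
open Summit.HodgeConjecture.HodgeConjecture.Cruxes.H413.F0P3cDyRamRowCellDigitShellDictionary (v_traceOne_add_map_mul_anti_eq_max)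
open Summit.HodgeConjecture.HodgeConjecture.Cruxes.H413.F0P3cDyRamRowVertexAffineCoordinate (exists_doublyFixed_coord)
open Summit.HodgeConjecture.HodgeConjecture.Cruxes.H413.F0P3cDyRamRowCellDigitClassSplit (classClause_of_far not_classClause'_of_far)
open Summit.HodgeConjecture.HodgeConjecture.Cruxes.H413.F0P3cDyRamRowCellDigitClassTwist (exists_twistUnit twist_line_letters twist_sub_twist twist_size_letters
  classClause_twist_iff_not classClause_iff_of_near)

variable {E M : Type} [Field E] [Valued E ℤᵐ⁰] [Field M] [Valued M ℤᵐ⁰] {ρ Θ : M →+* M} {α : M}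

/-! ## §1 HEAD — inner shells and the diagonal ball are balanced -/

/-- **HEAD — «INNER SHELLS AND THE DIAGONAL BALL ARE BALANCED».**  `jE`-letters on a complete `E` with finite residue field and the wild datum `IsRamifiedQuadraticDatum σ ϖ d tE`, `|2| < 1`,
`2 ≤ d`; `ρ` an isometric involution commuting with `Θ`; the ONE chart: `κ₀` of `ρ`-trace one, `Θ`-fixed, `|κ₀| = 1`, `ξ₀` `ρ`-anti, `Θ`-fixed, non-zero; a doubly-fixed scalar `c ≠ 0`; a
`σ`-fixed integral digit system `Rd`, complete (`hRd2`) and separated (`hRd3`) at precision `r`; a radius `R` with `1 ≤ R ≤ |ξ₀|`, `R·|ϖ|^{2d−2} < 1` (the diagonal ball `R = 1` or a cell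
`i ≤ d − 2`), `r·|ξ₀| < R`, `r·|ξ₀| ≤ |ϖ|^{2d−1}·R`.  THEN on the sphere `Rd.filter (max 1 (|V|·|ξ₀|) = R)` the digits with `CLASS_c` and those without are EQUINUMEROUS.
[cite: LabesseLanglands1979, §2 (2.2) p. 9] [cite: Serre1979, Ch. V §3 Prop. 5, Cor. 2–3 pp. 84–86; Ch. XV §2] [cite: Flicker1998UnitaryFL, Prop. 7 p. 84] [cite: Kottwitz1986BaseChangeUnits, §1 pp. 240–241] -/
theorem card_filter_class_eq_card_filter_not_class [CompleteSpace E] [Finite 𝓀[E]] {σ : E →+* E} {ϖ : E} {d tE : ℕ}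
    (hD : IsRamifiedQuadraticDatum σ ϖ d tE) (h2v : Valued.v (2 : E) < 1) (hd2 : 2 ≤ d)
    (jE : E →+* M) (hjfix : ∀ z, ρ z = z ↔ ∃ c, jE c = z) (hΘj : ∀ c, Θ (jE c) = jE (σ c)) (hjiso : ∀ a, Valued.v (jE a) = Valued.v a)
    (hρρ : ∀ x, ρ (ρ x) = x) (hvρ : ∀ x, Valued.v (ρ x) = Valued.v x) (hΘρ : ∀ x, Θ (ρ x) = ρ (Θ x))
    {κ₀ ξ₀ : M} (hκ₀ : κ₀ + ρ κ₀ = 1) (hΘκ₀ : Θ κ₀ = κ₀) (hκ₀1 : Valued.v κ₀ = 1) (hξ : ρ ξ₀ = -ξ₀) (hΘξ : Θ ξ₀ = ξ₀) (hξ0 : ξ₀ ≠ 0)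
    {c : M} (hρc : ρ c = c) (hΘc : Θ c = c) (hc : c ≠ 0)
    (Rd : Finset E) (hRd1 : ∀ V ∈ Rd, σ V = V ∧ Valued.v V ≤ 1) {r : ℤᵐ⁰}
    (hRd2 : ∀ V : E, σ V = V → Valued.v V ≤ 1 → ∃ V₀ ∈ Rd, Valued.v (V - V₀) ≤ r)
    (hRd3 : ∀ V ∈ Rd, ∀ V' ∈ Rd, Valued.v (V - V') ≤ r → V = V')
    {R : ℤᵐ⁰} (hR1 : 1 ≤ R) (hRξ : R ≤ Valued.v ξ₀) (hRin : R * Valued.v ϖ ^ (2 * d - 2) < 1)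
    (hrR : r * Valued.v ξ₀ < R) (hrc : r * Valued.v ξ₀ ≤ Valued.v ϖ ^ (2 * d - 1) * R)
    [DecidablePred fun V : E => max 1 (Valued.v V * Valued.v ξ₀) = R]
    [DecidablePred fun V : E => ∃ e : M, ρ e = e ∧ e * Θ e = (κ₀ + jE V * ξ₀) * ρ (κ₀ + jE V * ξ₀) / c] :
    ((Rd.filter fun V => max 1 (Valued.v V * Valued.v ξ₀) = R).filter
        fun V => ∃ e : M, ρ e = e ∧ e * Θ e = (κ₀ + jE V * ξ₀) * ρ (κ₀ + jE V * ξ₀) / c).card =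
      ((Rd.filter fun V => max 1 (Valued.v V * Valued.v ξ₀) = R).filter
        fun V => ¬ ∃ e : M, ρ e = e ∧ e * Θ e = (κ₀ + jE V * ξ₀) * ρ (κ₀ + jE V * ξ₀) / c).card := by
  obtain ⟨-, -, hϖ, -, -, hd1, -⟩ := id hD
  have hρj : ∀ a : E, ρ (jE a) = jE a := fun a => (hjfix _).2 ⟨a, rfl⟩
  have hξpos : 0 < Valued.v ξ₀ := zero_lt_iff.2 ((Valuation.ne_zero_iff _).2 hξ0)
  have hRpos : 0 < R := lt_of_lt_of_le zero_lt_one hR1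
  -- the twist unit and the index-two letters
  obtain ⟨t₀, hσt₀, ht₀, hΘη, hsmall1, hηN⟩ := exists_twistUnit hD h2v hd2 jE hjfix hΘj hjiso hρρ hvρ hΘρ hκ₀ hΘκ₀ hκ₀1
  obtain ⟨c₀, hρc₀, hΘc₀, hc₀n, hdich⟩ := exists_indexTwo_letters (ρ := ρ) (Θ := Θ) hD jE hjfix hΘj
  have hρs : ρ (jE t₀) = jE t₀ := hρj t₀
  -- the points `κ_V` and their letters
  have hline : ∀ V : E, σ V = V → (κ₀ + jE V * ξ₀) + ρ (κ₀ + jE V * ξ₀) = 1 ∧ Θ (κ₀ + jE V * ξ₀) = κ₀ + jE V * ξ₀ := fun V hσV =>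
    ⟨by rw [map_add, map_mul, hρj, hξ]; linear_combination hκ₀, by rw [map_add, map_mul, hΘκ₀, hΘj, hσV, hΘξ]⟩
  have hsize : ∀ V : E, Valued.v (κ₀ + jE V * ξ₀) = max 1 (Valued.v V * Valued.v ξ₀) := fun V =>
    v_traceOne_add_map_mul_anti_eq_max hvρ jE hρj hjiso hκ₀ hκ₀1 hξ V
  set S : Finset E := Rd.filter fun V => max 1 (Valued.v V * Valued.v ξ₀) = R with hSdef
  have hmemS : ∀ V, V ∈ S ↔ V ∈ Rd ∧ max 1 (Valued.v V * Valued.v ξ₀) = R := fun V => Finset.mem_filter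
  -- on the shell: `|κ_V| = R`, the twist letters
  have hsmall : ∀ V ∈ S, Valued.v (jE t₀) * Valued.v (κ₀ + jE V * ξ₀) < 1 := fun V hV => by
    rw [hsize V, ((hmemS V).1 hV).2, hjiso]
    calc Valued.v t₀ * R ≤ Valued.v ϖ ^ (2 * d - 2) * R := by gcongr
      _ = R * Valued.v ϖ ^ (2 * d - 2) := mul_comm _ _
      _ < 1 := hRin
  -- the twisted coordinate `Vp V` and its digit `Vs V`
  have key : ∀ V ∈ S, ∃ V' : E, σ V' = V' ∧ Valued.v V' ≤ 1 ∧
      (1 + jE t₀ * κ₀) * (κ₀ + jE V * ξ₀) / ((1 + jE t₀ * κ₀) * (κ₀ + jE V * ξ₀) + ρ ((1 + jE t₀ * κ₀) * (κ₀ + jE V * ξ₀))) = κ₀ + jE V' * ξ₀ := by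
    intro V hV
    obtain ⟨hσV, -⟩ := hRd1 V ((hmemS V).1 hV).1
    obtain ⟨hκtr, hΘκ⟩ := hline V hσV
    obtain ⟨-, -, hτ0, -, hTv⟩ := twist_size_letters (κ₀ := κ₀) hvρ hρs hκ₀1 hκtr (hsmall V hV)
    obtain ⟨hTtr, hΘT, -⟩ := twist_line_letters hρρ hΘρ hΘη hΘκ hτ0
    obtain ⟨V', hσV', hV'⟩ := exists_doublyFixed_coord jE hjfix hΘj hTtr hκ₀ hξ hξ0 hΘT hΘκ₀ hΘξ
    refine ⟨V', hσV', ?_, hV'⟩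
    -- `|V'| ≤ 1`: `|jE V' ξ₀| = |Tκ − κ₀| ≤ max R 1 = R ≤ |ξ₀|`
    have hTR : Valued.v (κ₀ + jE V' * ξ₀) = R := by rw [← hV', hTv, hsize V, ((hmemS V).1 hV).2]
    have h1 : Valued.v (jE V' * ξ₀) ≤ R := by
      have e : jE V' * ξ₀ = (κ₀ + jE V' * ξ₀) - κ₀ := by ring
      rw [e]; exact (Valuation.map_sub _ _ _).trans (max_le hTR.le (by rw [hκ₀1]; exact hR1))
    rw [Valuation.map_mul, hjiso] at h1
    exact le_of_mul_le_mul_right (h1.trans (by rw [one_mul]; exact hRξ)) hξpos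
  choose! Vp hσVp hVp1 hVpeq using key
  have key2 : ∀ V ∈ S, ∃ V₀ ∈ Rd, Valued.v (Vp V - V₀) ≤ r := fun V hV => hRd2 (Vp V) (hσVp V hV) (hVp1 V hV)
  choose! Vs hVsR hVsnear using key2
  -- (A) the digit `Vs V` is on the shell
  have hVpR : ∀ V ∈ S, Valued.v (κ₀ + jE (Vp V) * ξ₀) = R := fun V hV => by
    obtain ⟨hσV, -⟩ := hRd1 V ((hmemS V).1 hV).1
    obtain ⟨hκtr, -⟩ := hline V hσV
    obtain ⟨-, -, -, -, hTv⟩ := twist_size_letters (κ₀ := κ₀) hvρ hρs hκ₀1 hκtr (hsmall V hV)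
    rw [← hVpeq V hV, hTv, hsize V, ((hmemS V).1 hV).2]
  have hnearκ : ∀ V ∈ S, Valued.v ((κ₀ + jE (Vs V) * ξ₀) - (κ₀ + jE (Vp V) * ξ₀)) ≤ r * Valued.v ξ₀ := fun V hV => by
    have e : (κ₀ + jE (Vs V) * ξ₀) - (κ₀ + jE (Vp V) * ξ₀) = jE (Vs V - Vp V) * ξ₀ := by rw [map_sub]; ring
    rw [e, Valuation.map_mul, hjiso, Valuation.map_sub_swap]
    exact mul_le_mul' (hVsnear V hV) le_rfl
  have hVsR' : ∀ V ∈ S, Valued.v (κ₀ + jE (Vs V) * ξ₀) = R := fun V hV => by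
    have hlt : Valued.v ((κ₀ + jE (Vs V) * ξ₀) - (κ₀ + jE (Vp V) * ξ₀)) < Valued.v (κ₀ + jE (Vp V) * ξ₀) := by
      rw [hVpR V hV]; exact lt_of_le_of_lt (hnearκ V hV) hrR
    have e : κ₀ + jE (Vs V) * ξ₀ = (κ₀ + jE (Vp V) * ξ₀) + ((κ₀ + jE (Vs V) * ξ₀) - (κ₀ + jE (Vp V) * ξ₀)) := by ring
    rw [e, Valuation.map_add_eq_of_lt_left _ hlt, hVpR V hV]
  have hVsS : ∀ V ∈ S, Vs V ∈ S := fun V hV => (hmemS _).2 ⟨hVsR V hV, by rw [← hsize, hVsR' V hV]⟩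
  -- (B) the class flips
  have hflip : ∀ V ∈ S, ((∃ e : M, ρ e = e ∧ e * Θ e = (κ₀ + jE (Vs V) * ξ₀) * ρ (κ₀ + jE (Vs V) * ξ₀) / c) ↔
      ¬ ∃ e : M, ρ e = e ∧ e * Θ e = (κ₀ + jE V * ξ₀) * ρ (κ₀ + jE V * ξ₀) / c) := by
    intro V hV
    obtain ⟨hσV, -⟩ := hRd1 V ((hmemS V).1 hV).1
    obtain ⟨hκtr, hΘκ⟩ := hline V hσV
    obtain ⟨-, -, hτ0, hη1, -⟩ := twist_size_letters (κ₀ := κ₀) hvρ hρs hκ₀1 hκtr (hsmall V hV)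
    have hη0 : (1 + jE t₀ * κ₀) ≠ 0 := fun h0 => by rw [h0, Valuation.map_zero] at hη1; exact zero_ne_one hη1
    -- the digit and the twisted coordinate have the same class (near), the twisted coordinate the opposite class
    have hnear : Valued.v ((κ₀ + jE (Vs V) * ξ₀) - (κ₀ + jE (Vp V) * ξ₀)) ≤ Valued.v (jE ϖ) ^ (2 * d - 1) * Valued.v (κ₀ + jE (Vp V) * ξ₀) := by
      rw [hVpR V hV, hjiso]; exact (hnearκ V hV).trans hrc
    have hVp0 : κ₀ + jE (Vp V) * ξ₀ ≠ 0 := fun h0 => by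
      have := hVpR V hV; rw [h0, Valuation.map_zero] at this; exact (ne_of_gt hRpos) this.symm
    rw [classClause_iff_of_near hD jE hjfix hΘj hjiso hρρ hvρ hΘρ c (hline _ (hσVp V hV)).2 (hline _ (hRd1 _ (hVsR V hV)).1).2 hVp0 hnear,
      ← hVpeq V hV]
    exact classClause_twist_iff_not hρρ hΘρ hρc₀ hΘc₀ hc₀n hdich hΘη hη0 hηN hρc hΘc hc hκtr hΘκ hτ0
  -- (C) the digit map is injective on the shell
  have hinj : Set.InjOn Vs (S : Set E) := by
    intro V₁ hV₁ V₂ hV₂ hEq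
    rw [Finset.mem_coe] at hV₁ hV₂
    obtain ⟨hσV₁, -⟩ := hRd1 V₁ ((hmemS V₁).1 hV₁).1
    obtain ⟨hσV₂, -⟩ := hRd1 V₂ ((hmemS V₂).1 hV₂).1
    obtain ⟨hκtr₁, -⟩ := hline V₁ hσV₁
    obtain ⟨hκtr₂, -⟩ := hline V₂ hσV₂
    obtain ⟨-, hτv₁, hτ0₁, hη1, -⟩ := twist_size_letters (κ₀ := κ₀) hvρ hρs hκ₀1 hκtr₁ (hsmall V₁ hV₁)
    obtain ⟨-, hτv₂, hτ0₂, -, -⟩ := twist_size_letters (κ₀ := κ₀) hvρ hρs hκ₀1 hκtr₂ (hsmall V₂ hV₂)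
    -- `|Vp V₁ − Vp V₂| ≤ r`
    have hVp : Valued.v (Vp V₁ - Vp V₂) ≤ r := by
      have e : Vp V₁ - Vp V₂ = (Vp V₁ - Vs V₁) - (Vp V₂ - Vs V₂) := by rw [hEq]; ring
      rw [e]; exact (Valuation.map_sub _ _ _).trans (max_le (hVsnear V₁ hV₁) (hVsnear V₂ hV₂))
    -- `|Tκ₁ − Tκ₂| ≤ r|ξ₀|`, and `Tκ₁ − Tκ₂ = ηρη(κ₁ − κ₂)/(τ₁τ₂)` with unit factors
    have hT : Valued.v ((κ₀ + jE (Vp V₁) * ξ₀) - (κ₀ + jE (Vp V₂) * ξ₀)) ≤ r * Valued.v ξ₀ := by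
      have e : (κ₀ + jE (Vp V₁) * ξ₀) - (κ₀ + jE (Vp V₂) * ξ₀) = jE (Vp V₁ - Vp V₂) * ξ₀ := by rw [map_sub]; ring
      rw [e, Valuation.map_mul, hjiso]; exact mul_le_mul' hVp le_rfl
    rw [← hVpeq V₁ hV₁, ← hVpeq V₂ hV₂, twist_sub_twist hκtr₁ hκtr₂ hτ0₁ hτ0₂, map_div₀, Valuation.map_mul, Valuation.map_mul,
      Valuation.map_mul, hvρ, hη1, hτv₁, hτv₂] at hT
    simp only [one_mul, mul_one, div_one] at hT
    have e : (κ₀ + jE V₁ * ξ₀) - (κ₀ + jE V₂ * ξ₀) = jE (V₁ - V₂) * ξ₀ := by rw [map_sub]; ring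
    rw [e, Valuation.map_mul, hjiso] at hT
    exact hRd3 V₁ ((hmemS V₁).1 hV₁).1 V₂ ((hmemS V₂).1 hV₂).1 (le_of_mul_le_mul_right hT hξpos)
  -- (D) count both ways
  apply le_antisymm
  · refine Finset.card_le_card_of_injOn Vs (fun V hV => ?_) (hinj.mono (by intro V hV; exact (Finset.mem_filter.1 hV).1))
    obtain ⟨hVS, hVc⟩ := Finset.mem_filter.1 hV
    exact Finset.mem_filter.2 ⟨hVsS V hVS, fun h => (hflip V hVS).1 h hVc⟩
  · refine Finset.card_le_card_of_injOn Vs (fun V hV => ?_) (hinj.mono (by intro V hV; exact (Finset.mem_filter.1 hV).1))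
    obtain ⟨hVS, hVc⟩ := Finset.mem_filter.1 hV
    exact Finset.mem_filter.2 ⟨hVsS V hVS, (hflip V hVS).2 hVc⟩


/-- **`2·#(CLASS_c digits) = #(sphere digits)`** on a balanced sphere (frame of the HEAD) — the letters `hL0` (`R = 1`) and `hLNear` (`R = exp 2i`, `1 ≤ i ≤ d − 2`) of ★ p864447
`density_of_tables` once the sphere total is read from ★ p864509. [cite: LabesseLanglands1979, §2 (2.2) p. 9] [cite: Flicker1998UnitaryFL, Prop. 7 p. 84] -/
theorem two_mul_card_filter_class_eq_card [CompleteSpace E] [Finite 𝓀[E]] {σ : E →+* E} {ϖ : E} {d tE : ℕ}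
    (hD : IsRamifiedQuadraticDatum σ ϖ d tE) (h2v : Valued.v (2 : E) < 1) (hd2 : 2 ≤ d)
    (jE : E →+* M) (hjfix : ∀ z, ρ z = z ↔ ∃ c, jE c = z) (hΘj : ∀ c, Θ (jE c) = jE (σ c)) (hjiso : ∀ a, Valued.v (jE a) = Valued.v a)
    (hρρ : ∀ x, ρ (ρ x) = x) (hvρ : ∀ x, Valued.v (ρ x) = Valued.v x) (hΘρ : ∀ x, Θ (ρ x) = ρ (Θ x))
    {κ₀ ξ₀ : M} (hκ₀ : κ₀ + ρ κ₀ = 1) (hΘκ₀ : Θ κ₀ = κ₀) (hκ₀1 : Valued.v κ₀ = 1) (hξ : ρ ξ₀ = -ξ₀) (hΘξ : Θ ξ₀ = ξ₀) (hξ0 : ξ₀ ≠ 0)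
    {c : M} (hρc : ρ c = c) (hΘc : Θ c = c) (hc : c ≠ 0)
    (Rd : Finset E) (hRd1 : ∀ V ∈ Rd, σ V = V ∧ Valued.v V ≤ 1) {r : ℤᵐ⁰}
    (hRd2 : ∀ V : E, σ V = V → Valued.v V ≤ 1 → ∃ V₀ ∈ Rd, Valued.v (V - V₀) ≤ r)
    (hRd3 : ∀ V ∈ Rd, ∀ V' ∈ Rd, Valued.v (V - V') ≤ r → V = V')
    {R : ℤᵐ⁰} (hR1 : 1 ≤ R) (hRξ : R ≤ Valued.v ξ₀) (hRin : R * Valued.v ϖ ^ (2 * d - 2) < 1)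
    (hrR : r * Valued.v ξ₀ < R) (hrc : r * Valued.v ξ₀ ≤ Valued.v ϖ ^ (2 * d - 1) * R)
    [DecidablePred fun V : E => max 1 (Valued.v V * Valued.v ξ₀) = R]
    [DecidablePred fun V : E => ∃ e : M, ρ e = e ∧ e * Θ e = (κ₀ + jE V * ξ₀) * ρ (κ₀ + jE V * ξ₀) / c] :
    2 * ((Rd.filter fun V => max 1 (Valued.v V * Valued.v ξ₀) = R).filter
        fun V => ∃ e : M, ρ e = e ∧ e * Θ e = (κ₀ + jE V * ξ₀) * ρ (κ₀ + jE V * ξ₀) / c).card =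
      (Rd.filter fun V => max 1 (Valued.v V * Valued.v ξ₀) = R).card := by
  have h := card_filter_class_eq_card_filter_not_class hD h2v hd2 jE hjfix hΘj hjiso hρρ hvρ hΘρ hκ₀ hΘκ₀ hκ₀1 hξ hΘξ hξ0 hρc hΘc hc Rd hRd1 hRd2 hRd3
    hR1 hRξ hRin hrR hrc
  have hsum := Finset.card_filter_add_card_filter_not (s := Rd.filter fun V => max 1 (Valued.v V * Valued.v ξ₀) = R)
    (fun V => ∃ e : M, ρ e = e ∧ e * Θ e = (κ₀ + jE V * ξ₀) * ρ (κ₀ + jE V * ξ₀) / c)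
  rw [← h] at hsum
  rw [← hsum, two_mul]

/-! ## §2 Far shells are one-class — the counts -/

/-- **FAR SHELLS: EVERY DIGIT IS OF THE HYPERBOLIC CLASS, NONE OF THE ANISOTROPIC CLASS — AS FILTERS.**  The CORE frame of ★ p864480 `classClause_iff_not_classClause` (line models
`(φ, h)` hyperbolic and `(φ′, h′)` anisotropic, frame equation with `η ∉ N(E^×)`), the chart letters with `|κ₀| = 1`, and a finite set `S` of `σ`-fixed digits all on far shells
(`exp(2d − 1) ≤ |V|·|ξ₀|`).  THEN `S.filter CLASS_h = S` and `S.filter CLASS_{h′} = ∅`; hence `#(S.filter CLASS_h) = #S`, `#(S.filter CLASS_{h′}) = 0` (= `hLFar`).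
[cite: Serre1979, Ch. V §3 Prop. 5, Cor. 2–3 pp. 84–86; Ch. XV §2] [cite: Flicker1998UnitaryFL, Prop. 7 p. 84] -/
theorem filter_class_of_far [CompleteSpace E] [Finite 𝓀[E]] {σ : E →+* E} {ϖ : E} {d tE : ℕ} (hD : IsRamifiedQuadraticDatum σ ϖ d tE)
    (jE : E →+* M) (hjfix : ∀ z, ρ z = z ↔ ∃ c, jE c = z) (hΘj : ∀ c, Θ (jE c) = jE (σ c)) (hjiso : ∀ a, Valued.v (jE a) = Valued.v a)
    (hρρ : ∀ x, ρ (ρ x) = x) (hvρ : ∀ x, Valued.v (ρ x) = Valued.v x) (hΘρ : ∀ x, Θ (ρ x) = ρ (Θ x))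
    (P₁ : GL (Fin 3) E) (dg : Fin 2 → E) (η : E)
    (hA : formCongr σ P₁ ((StdForm.antidiagonal 3).over E) =
      (!![(Matrix.diagonal dg) 0 0, 0, (Matrix.diagonal dg) 0 1; 0, η, 0; (Matrix.diagonal dg) 1 0, 0, (Matrix.diagonal dg) 1 1] : Matrix (Fin 3) (Fin 3) E))
    (hηN : ¬ ∃ t : E, t * σ t = η)
    (φ : (Fin 2 → E) →+ M) {h : M} (hform : ∀ x y, jE (pairing σ ((StdForm.antidiagonal 2).over E) x y) = h * Θ (φ x) * φ y + ρ (h * Θ (φ x) * φ y))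
    (hΘh : Θ h = h) (hh : h ≠ 0)
    (φ' : (Fin 2 → E) →+ M) {h' : M} (hform' : ∀ x y, jE (pairing σ (Matrix.diagonal dg) x y) = h' * Θ (φ' x) * φ' y + ρ (h' * Θ (φ' x) * φ' y))
    (hΘh' : Θ h' = h') (hh' : h' ≠ 0)
    {κ₀ ξ₀ : M} (hκ₀ : κ₀ + ρ κ₀ = 1) (hΘκ₀ : Θ κ₀ = κ₀) (hκ₀1 : Valued.v κ₀ = 1) (hξ : ρ ξ₀ = -ξ₀) (hΘξ : Θ ξ₀ = ξ₀)
    (S : Finset E) (hS : ∀ V ∈ S, σ V = V ∧ exp (2 * (d : ℤ) - 1) ≤ Valued.v V * Valued.v ξ₀)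
    [DecidablePred fun V : E => ∃ e : M, ρ e = e ∧ e * Θ e = (κ₀ + jE V * ξ₀) * ρ (κ₀ + jE V * ξ₀) / (h * ρ h)]
    [DecidablePred fun V : E => ∃ e : M, ρ e = e ∧ e * Θ e = (κ₀ + jE V * ξ₀) * ρ (κ₀ + jE V * ξ₀) / (h' * ρ h')] :
    (S.filter fun V => ∃ e : M, ρ e = e ∧ e * Θ e = (κ₀ + jE V * ξ₀) * ρ (κ₀ + jE V * ξ₀) / (h * ρ h)) = S ∧
      (S.filter fun V => ∃ e : M, ρ e = e ∧ e * Θ e = (κ₀ + jE V * ξ₀) * ρ (κ₀ + jE V * ξ₀) / (h' * ρ h')) = ∅ := by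
  refine ⟨Finset.filter_true_of_mem fun V hV => ?_, Finset.filter_false_of_mem fun V hV => ?_⟩
  · exact classClause_of_far hD jE hjfix hΘj hjiso hρρ hvρ hΘρ φ hform hΘκ₀ hκ₀1 hξ hΘξ (hS V hV).1 (hS V hV).2
  · exact not_classClause'_of_far hD jE hjfix hΘj hjiso hρρ hvρ hΘρ P₁ dg η hA hηN φ hform hΘh hh φ' hform' hΘh' hh' hκ₀ hΘκ₀ hκ₀1 hξ hΘξ
      (hS V hV).1 (hS V hV).2

/-- **FAR SHELLS — THE COUNTS** (`hLFar`): frame of `filter_class_of_far`; `#(S.filter CLASS_h) = #S` and `#(S.filter CLASS_{h′}) = 0`.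
[cite: Serre1979, Ch. V §3 Prop. 5, Cor. 2–3 pp. 84–86] [cite: Flicker1998UnitaryFL, Prop. 7 p. 84] -/
theorem card_filter_class_of_far [CompleteSpace E] [Finite 𝓀[E]] {σ : E →+* E} {ϖ : E} {d tE : ℕ} (hD : IsRamifiedQuadraticDatum σ ϖ d tE)
    (jE : E →+* M) (hjfix : ∀ z, ρ z = z ↔ ∃ c, jE c = z) (hΘj : ∀ c, Θ (jE c) = jE (σ c)) (hjiso : ∀ a, Valued.v (jE a) = Valued.v a)
    (hρρ : ∀ x, ρ (ρ x) = x) (hvρ : ∀ x, Valued.v (ρ x) = Valued.v x) (hΘρ : ∀ x, Θ (ρ x) = ρ (Θ x))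
    (P₁ : GL (Fin 3) E) (dg : Fin 2 → E) (η : E)
    (hA : formCongr σ P₁ ((StdForm.antidiagonal 3).over E) =
      (!![(Matrix.diagonal dg) 0 0, 0, (Matrix.diagonal dg) 0 1; 0, η, 0; (Matrix.diagonal dg) 1 0, 0, (Matrix.diagonal dg) 1 1] : Matrix (Fin 3) (Fin 3) E))
    (hηN : ¬ ∃ t : E, t * σ t = η)
    (φ : (Fin 2 → E) →+ M) {h : M} (hform : ∀ x y, jE (pairing σ ((StdForm.antidiagonal 2).over E) x y) = h * Θ (φ x) * φ y + ρ (h * Θ (φ x) * φ y))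
    (hΘh : Θ h = h) (hh : h ≠ 0)
    (φ' : (Fin 2 → E) →+ M) {h' : M} (hform' : ∀ x y, jE (pairing σ (Matrix.diagonal dg) x y) = h' * Θ (φ' x) * φ' y + ρ (h' * Θ (φ' x) * φ' y))
    (hΘh' : Θ h' = h') (hh' : h' ≠ 0)
    {κ₀ ξ₀ : M} (hκ₀ : κ₀ + ρ κ₀ = 1) (hΘκ₀ : Θ κ₀ = κ₀) (hκ₀1 : Valued.v κ₀ = 1) (hξ : ρ ξ₀ = -ξ₀) (hΘξ : Θ ξ₀ = ξ₀)
    (S : Finset E) (hS : ∀ V ∈ S, σ V = V ∧ exp (2 * (d : ℤ) - 1) ≤ Valued.v V * Valued.v ξ₀)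
    [DecidablePred fun V : E => ∃ e : M, ρ e = e ∧ e * Θ e = (κ₀ + jE V * ξ₀) * ρ (κ₀ + jE V * ξ₀) / (h * ρ h)]
    [DecidablePred fun V : E => ∃ e : M, ρ e = e ∧ e * Θ e = (κ₀ + jE V * ξ₀) * ρ (κ₀ + jE V * ξ₀) / (h' * ρ h')] :
    (S.filter fun V => ∃ e : M, ρ e = e ∧ e * Θ e = (κ₀ + jE V * ξ₀) * ρ (κ₀ + jE V * ξ₀) / (h * ρ h)).card = S.card ∧
      (S.filter fun V => ∃ e : M, ρ e = e ∧ e * Θ e = (κ₀ + jE V * ξ₀) * ρ (κ₀ + jE V * ξ₀) / (h' * ρ h')).card = 0 := by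
  obtain ⟨h1, h2⟩ := filter_class_of_far hD jE hjfix hΘj hjiso hρρ hvρ hΘρ P₁ dg η hA hηN φ hform hΘh hh φ' hform' hΘh' hh' hκ₀ hΘκ₀ hκ₀1 hξ hΘξ S hS
  exact ⟨by rw [h1], by rw [h2, Finset.card_empty]⟩

end Summit.HodgeConjecture.HodgeConjecture.Cruxes.H413.F0P3cDyRamRowCellDigitClassBalance

end
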